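import Summits.Ventures.HodgeRepro.RectQuadOdd

/-!
# The involution rectangle needs `|G| ≥ 8k` — the threshold is sharp

Blind re-derivation cell `pub-hodge-repro`, seat `p1` (gen 10).  The converse of `exists_rectQuad_odd`: for every
finite `(G, c)`, every involution `u ∉ {1, c}` and every `w` of odd order `k ≥ 3` commuting with `u`, a CM type
`Φ` with `Φ, Φu, Φ(wc), Φ(uwc)` `SumTwo` WITHOUT a conjugate pair forces `8k ≤ |G|`
(`eight_mul_le_card_of_rectQuad`); with `exists_rectQuad_odd` this is an IFF (`exists_rectQuad_odd_iff`), the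
analogue for the fourth mechanism of `exists_cyclicQuad_iff` (`16`) and `exists_kleinQuad_iff` (`24`).  Census
control: `C₂ × C₂₂` and `C₂ × C₂₆` (all `c`) are EMPTY — `|G| = 4p < 8p`.

Proof.  `W = ⟨u, w, c⟩ ≅ ℤ/2 × ℤ/k × ℤ/2` has order `4k` and `|G|` is a multiple of it (Lagrange), so `|G| < 8k`
forces `G = W`.  On `W` read `Φ` as a pattern `χ : ℤ/2 × ℤ/k × ℤ/2 → Bool` and put
`S(a, e) = χ(0, a, e) + χ(1, a, e) ∈ {0, 1, 2}` (the row sum over the `u`-coset, `rowSum`).  `SumTwo` at `(s, a, e)`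
reads `S(a, e) + S(a − 1, e − 1) = 2`, the CM condition `S(a, e + 1) = 2 − S(a, e)`; together `S(a − 1, e) = S(a, e)`,
so `S` does not depend on `a` (`ℤ/k` is generated by `1`: `rowSum_const`).  Three cases (`exists_conj_local`):
`S ≡ 1` makes `χ(s + 1, a, e) = ¬χ(s, a, e)`, i.e. `Φ u c = Φ` — the conjugate pair `(0, 1)`; `S(·, 0) = 0` resp.
`2` makes `χ = [e = 1]` resp. `[e = 0]`, which is `w`-invariant, i.e. `Φ (wc) c = Φ` — the conjugate pair `(0, 2)`.
Nothing uses `k` odd except the injectivity of `(i, a, e) ↦ uⁱ wᵃ cᵉ` (`rectHom_injective`).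
-/

set_option autoImplicit false

open Finset
open scoped Pointwise

namespace HodgeRepro.CosetQuad

variable {G : Type*} [Group G]

/-- Two of four Booleans hold iff their `toNat`s sum to `2`. -/
theorem card_filter_vec_eq_two_iff (b₀ b₁ b₂ b₃ : Bool) :
    (univ.filter fun j : Fin 4 => ![b₀, b₁, b₂, b₃] j = true).card = 2 ↔
      b₀.toNat + b₁.toNat + b₂.toNat + b₃.toNat = 2 := by
  cases b₀ <;> cases b₁ <;> cases b₂ <;> cases b₃ <;> decide

/-- Every element of `ℤ/2` (multiplicatively) is `1` or `ofAdd 1`. -/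
theorem zmod2_cases (s : Multiplicative (ZMod 2)) : s = 1 ∨ s = Multiplicative.ofAdd 1 := by
  revert s; decide

/-- `ofAdd (-1) = ofAdd 1` in `ℤ/2`. -/
theorem zmod2_ofAdd_neg_one : (Multiplicative.ofAdd (-1 : ZMod 2)) = Multiplicative.ofAdd 1 := by decide

/-- `ofAdd 1 * ofAdd 1 = 1` in `ℤ/2`. -/
theorem zmod2_ofAdd_one_sq : (Multiplicative.ofAdd (1 : ZMod 2)) * Multiplicative.ofAdd 1 = 1 := by decide

/-- `toNat` of a negation. -/
theorem toNat_not_add (b : Bool) : (!b).toNat + b.toNat = 1 := by cases b <;> rfl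

/-- `b₀ + b₁ = 1` forces `b₁ = ¬b₀`. -/
theorem eq_not_of_toNat_add_eq_one {b₀ b₁ : Bool} (h : b₀.toNat + b₁.toNat = 1) : b₁ = !b₀ := by
  cases b₀ <;> cases b₁ <;> simp_all

/-- `b₀ + b₁ = 0` forces both false. -/
theorem eq_false_of_toNat_add_eq_zero {b₀ b₁ : Bool} (h : b₀.toNat + b₁.toNat = 0) :
    b₀ = false ∧ b₁ = false := by
  cases b₀ <;> cases b₁ <;> simp_all

/-- `b₀ + b₁ = 2` forces both true. -/
theorem eq_true_of_toNat_add_eq_two {b₀ b₁ : Bool} (h : b₀.toNat + b₁.toNat = 2) :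
    b₀ = true ∧ b₁ = true := by
  cases b₀ <;> cases b₁ <;> simp_all

section Local

variable (k : ℕ)

/-- The row sum of a pattern over the `u`-coset `{(0, a, e), (1, a, e)}`. -/
def rowSum (χ : PR k → Bool) (a : Multiplicative (ZMod k)) (e : Multiplicative (ZMod 2)) : ℕ :=
  (χ (1, a, e)).toNat + (χ (Multiplicative.ofAdd 1, a, e)).toNat

/-- The two values at `s` and `s · ofAdd 1` sum to the row sum, whatever `s` is. -/
theorem toNat_add_toNat_eq_rowSum (χ : PR k → Bool) (s : Multiplicative (ZMod 2))
    (a : Multiplicative (ZMod k)) (e : Multiplicative (ZMod 2)) :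
    (χ (s, a, e)).toNat + (χ (s * Multiplicative.ofAdd 1, a, e)).toNat = rowSum k χ a e := by
  rcases zmod2_cases s with rfl | rfl
  · rw [one_mul]; rfl
  · rw [zmod2_ofAdd_one_sq, rowSum, add_comm]

variable [NeZero k]

omit [NeZero k] in
/-- The local `SumTwo` in row-sum form: `S(a, e) + S(a − 1, e − 1) = 2`. -/
theorem rowSum_add_rowSum (χ : PR k → Bool)
    (hst : ∀ p : PR k, (univ.filter fun j : Fin 4 => χ (p * (rectTwist k j)⁻¹) = true).card = 2)
    (a : Multiplicative (ZMod k)) (e : Multiplicative (ZMod 2)) :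
    rowSum k χ a e + rowSum k χ (a * Multiplicative.ofAdd (-1)) (e * Multiplicative.ofAdd 1) = 2 := by
  obtain ⟨h0, h1, h2, h3⟩ := mul_rectTwist_inv k 1 a e
  have h := hst (1, a, e)
  rw [zmod2_ofAdd_neg_one] at h1 h2 h3
  have hv : (univ.filter fun j : Fin 4 => χ ((1, a, e) * (rectTwist k j)⁻¹) = true) =
      univ.filter fun j : Fin 4 => ![χ (1, a, e), χ (1 * Multiplicative.ofAdd 1, a, e),
        χ (1, a * Multiplicative.ofAdd (-1), e * Multiplicative.ofAdd 1),
        χ (1 * Multiplicative.ofAdd 1, a * Multiplicative.ofAdd (-1), e * Multiplicative.ofAdd 1)] j = true := by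
    apply Finset.filter_congr
    intro j _
    fin_cases j
    · show χ ((1, a, e) * (rectTwist k 0)⁻¹) = true ↔ χ (1, a, e) = true
      rw [h0]
    · show χ ((1, a, e) * (rectTwist k 1)⁻¹) = true ↔ χ (1 * Multiplicative.ofAdd 1, a, e) = true
      rw [h1]
    · show χ ((1, a, e) * (rectTwist k 2)⁻¹) = true ↔
        χ (1, a * Multiplicative.ofAdd (-1), e * Multiplicative.ofAdd 1) = true
      rw [h2]
    · show χ ((1, a, e) * (rectTwist k 3)⁻¹) = true ↔
        χ (1 * Multiplicative.ofAdd 1, a * Multiplicative.ofAdd (-1), e * Multiplicative.ofAdd 1) = true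
      rw [h3]
  rw [hv, card_filter_vec_eq_two_iff] at h
  rw [← toNat_add_toNat_eq_rowSum k χ 1 a e, ← toNat_add_toNat_eq_rowSum k χ 1]
  omega

omit [NeZero k] in
/-- The CM condition in row-sum form: `S(a, e + 1) + S(a, e) = 2`. -/
theorem rowSum_conj_add (χ : PR k → Bool) (hcm : ∀ p : PR k, χ (p * rectConj k) = !χ p)
    (a : Multiplicative (ZMod k)) (e : Multiplicative (ZMod 2)) :
    rowSum k χ a (e * Multiplicative.ofAdd 1) + rowSum k χ a e = 2 := by
  have h1 := hcm (1, a, e)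
  have h2 := hcm (Multiplicative.ofAdd 1, a, e)
  have e1 : ((1 : Multiplicative (ZMod 2)), a, e) * rectConj k = (1, a, e * Multiplicative.ofAdd 1) := by
    show ((1 : Multiplicative (ZMod 2)), a, e) * (1, 1, Multiplicative.ofAdd 1) = (1, a, e * Multiplicative.ofAdd 1)
    simp only [Prod.mk_mul_mk, mul_one]
  have e2 : ((Multiplicative.ofAdd 1 : Multiplicative (ZMod 2)), a, e) * rectConj k =
      (Multiplicative.ofAdd 1, a, e * Multiplicative.ofAdd 1) := by
    show ((Multiplicative.ofAdd 1 : Multiplicative (ZMod 2)), a, e) * (1, 1, Multiplicative.ofAdd 1) =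
      (Multiplicative.ofAdd 1, a, e * Multiplicative.ofAdd 1)
    simp only [Prod.mk_mul_mk, mul_one]
  rw [e1] at h1
  rw [e2] at h2
  unfold rowSum
  rw [h1, h2]
  have := toNat_not_add (χ (1, a, e))
  have := toNat_not_add (χ (Multiplicative.ofAdd 1, a, e))
  omega

omit [NeZero k] in
/-- `S(a − 1, e) = S(a, e)`. -/
theorem rowSum_shift (χ : PR k → Bool) (hcm : ∀ p : PR k, χ (p * rectConj k) = !χ p)
    (hst : ∀ p : PR k, (univ.filter fun j : Fin 4 => χ (p * (rectTwist k j)⁻¹) = true).card = 2)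
    (a : Multiplicative (ZMod k)) (e : Multiplicative (ZMod 2)) :
    rowSum k χ (a * Multiplicative.ofAdd (-1)) e = rowSum k χ a e := by
  have h1 := rowSum_add_rowSum k χ hst a (e * Multiplicative.ofAdd 1)
  have h2 := rowSum_conj_add k χ hcm a e
  rw [mul_assoc, zmod2_ofAdd_one_sq, mul_one] at h1
  omega

/-- The row sum does not depend on `a`. -/
theorem rowSum_const (χ : PR k → Bool) (hcm : ∀ p : PR k, χ (p * rectConj k) = !χ p)
    (hst : ∀ p : PR k, (univ.filter fun j : Fin 4 => χ (p * (rectTwist k j)⁻¹) = true).card = 2)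
    (a : Multiplicative (ZMod k)) (e : Multiplicative (ZMod 2)) :
    rowSum k χ a e = rowSum k χ 1 e := by
  -- `S(a · ofAdd 1, e) = S(a, e)` from the shift with `a ↦ a · ofAdd 1`
  have step : ∀ a : Multiplicative (ZMod k),
      rowSum k χ (a * Multiplicative.ofAdd 1) e = rowSum k χ a e := by
    intro a
    have := rowSum_shift k χ hcm hst (a * Multiplicative.ofAdd 1) e
    rw [mul_assoc, ← ofAdd_add, add_neg_cancel, ofAdd_zero, mul_one] at this
    exact this.symm
  have key : ∀ m : ℕ, rowSum k χ (Multiplicative.ofAdd (m : ZMod k)) e = rowSum k χ 1 e := by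
    intro m
    induction m with
    | zero => rw [Nat.cast_zero, ofAdd_zero]
    | succ m ih => rw [Nat.cast_succ, ofAdd_add, step, ih]
  have := key (Multiplicative.toAdd a).val
  rwa [ZMod.natCast_zmod_val, ofAdd_toAdd] at this

/-- **The local theorem.**  A pattern on `ℤ/2 × ℤ/k × ℤ/2` satisfying the CM condition and the local `SumTwo`
of the rectangle has a conjugate pair: either `Φ u c = Φ` (pair `(0, 1)`) or `Φ (wc) c = Φ` (pair `(0, 2)`). -/
theorem exists_conj_local (χ : PR k → Bool) (hcm : ∀ p : PR k, χ (p * rectConj k) = !χ p)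
    (hst : ∀ p : PR k, (univ.filter fun j : Fin 4 => χ (p * (rectTwist k j)⁻¹) = true).card = 2) :
    ∃ i j : Fin 4, ∀ p : PR k,
      χ (p * (rectTwist k j)⁻¹) = χ (p * (rectConj k * (rectTwist k i)⁻¹)) := by
  have hconst := rowSum_const k χ hcm hst
  have hcm' : ∀ (s : Multiplicative (ZMod 2)) (a : Multiplicative (ZMod k)) (e : Multiplicative (ZMod 2)),
      χ (s, a, e * Multiplicative.ofAdd 1) = !χ (s, a, e) := by
    intro s a e
    have := hcm (s, a, e)
    rwa [show ((s, a, e) : PR k) * rectConj k = (s, a, e * Multiplicative.ofAdd 1) from by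
      show ((s, a, e) : PR k) * (1, 1, Multiplicative.ofAdd 1) = (s, a, e * Multiplicative.ofAdd 1)
      simp only [Prod.mk_mul_mk, mul_one]] at this
  -- the two translates that appear
  have t1 : ∀ p : PR k, p * (rectTwist k 1)⁻¹ = (p.1 * Multiplicative.ofAdd 1, p.2.1, p.2.2) := by
    rintro ⟨s, a, e⟩
    have := (mul_rectTwist_inv k s a e).2.1
    rwa [zmod2_ofAdd_neg_one] at this
  have t2 : ∀ p : PR k, p * (rectTwist k 2)⁻¹ =
      (p.1, p.2.1 * Multiplicative.ofAdd (-1), p.2.2 * Multiplicative.ofAdd 1) := by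
    rintro ⟨s, a, e⟩
    have := (mul_rectTwist_inv k s a e).2.2.1
    rwa [zmod2_ofAdd_neg_one] at this
  have t0c : ∀ p : PR k, p * (rectConj k * (rectTwist k 0)⁻¹) = (p.1, p.2.1, p.2.2 * Multiplicative.ofAdd 1) := by
    rintro ⟨s, a, e⟩
    show ((s, a, e) : PR k) * ((1, 1, Multiplicative.ofAdd 1) * (1, 1, 1)⁻¹) =
      (s, a, e * Multiplicative.ofAdd 1)
    simp only [Prod.inv_mk, inv_one, Prod.mk_mul_mk, mul_one]
  have hle : ∀ b : Bool, b.toNat ≤ 1 := by decide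
  have hr1 := rowSum_conj_add k χ hcm 1 1
  rw [one_mul] at hr1
  have hb0 := hle (χ (1, 1, 1)); have hb1 := hle (χ (Multiplicative.ofAdd 1, 1, 1))
  have h3 : rowSum k χ 1 1 = 0 ∨ rowSum k χ 1 1 = 1 ∨ rowSum k χ 1 1 = 2 := by
    unfold rowSum; omega
  rcases h3 with h0 | h1 | h2
  · -- `S(·, 1) = 0`, `S(·, ofAdd 1) = 2`: `χ = [e = ofAdd 1]`, stable under `w c`: the pair `(0, 2)`
    refine ⟨0, 2, ?_⟩
    have hval : ∀ (s : Multiplicative (ZMod 2)) (a : Multiplicative (ZMod k)) (e : Multiplicative (ZMod 2)),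
        χ (s, a, e) = decide (e = Multiplicative.ofAdd 1) := by
      intro s a e
      have hA := hconst a 1
      have hB := hconst a (Multiplicative.ofAdd 1)
      rw [h0] at hA
      rw [show rowSum k χ 1 (Multiplicative.ofAdd 1) = 2 by omega] at hB
      obtain ⟨f0, f1⟩ := eq_false_of_toNat_add_eq_zero hA
      obtain ⟨g0, g1⟩ := eq_true_of_toNat_add_eq_two hB
      rcases zmod2_cases s with rfl | rfl <;> rcases zmod2_cases e with rfl | rfl
      · rw [f0]; decide
      · rw [g0]; decide
      · rw [f1]; decide
      · rw [g1]; decide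
    intro p
    rw [t2, t0c, hval, hval]
  · -- `S ≡ 1`: `χ(s · ofAdd 1, a, e) = ¬χ(s, a, e)`, so `Φ u c = Φ`: the pair `(0, 1)`
    refine ⟨0, 1, ?_⟩
    have hflip : ∀ (s : Multiplicative (ZMod 2)) (a : Multiplicative (ZMod k)) (e : Multiplicative (ZMod 2)),
        χ (s * Multiplicative.ofAdd 1, a, e) = !χ (s, a, e) := by
      intro s a e
      have hA := hconst a e
      have he : rowSum k χ 1 e = 1 := by
        rcases zmod2_cases e with rfl | rfl
        · exact h1
        · omega
      rw [he] at hA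
      have hn := eq_not_of_toNat_add_eq_one hA
      rcases zmod2_cases s with rfl | rfl
      · rw [one_mul]; exact hn
      · rw [zmod2_ofAdd_one_sq, hn, Bool.not_not]
    intro p
    rw [t1, t0c, hflip, hcm']
  · -- `S(·, 1) = 2`, `S(·, ofAdd 1) = 0`: `χ = [e = 1]`: the pair `(0, 2)`
    refine ⟨0, 2, ?_⟩
    have hval : ∀ (s : Multiplicative (ZMod 2)) (a : Multiplicative (ZMod k)) (e : Multiplicative (ZMod 2)),
        χ (s, a, e) = decide (e = 1) := by
      intro s a e
      have hA := hconst a 1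
      have hB := hconst a (Multiplicative.ofAdd 1)
      rw [h2] at hA
      rw [show rowSum k χ 1 (Multiplicative.ofAdd 1) = 0 by omega] at hB
      obtain ⟨f0, f1⟩ := eq_true_of_toNat_add_eq_two hA
      obtain ⟨g0, g1⟩ := eq_false_of_toNat_add_eq_zero hB
      rcases zmod2_cases s with rfl | rfl <;> rcases zmod2_cases e with rfl | rfl
      · rw [f0]; decide
      · rw [g0]; decide
      · rw [f1]; decide
      · rw [g1]; decide
    intro p
    rw [t2, t0c, hval, hval]

end Local

/-- `|ℤ/2 × ℤ/k × ℤ/2| = 4k`. -/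
theorem card_PR (k : ℕ) [NeZero k] : Fintype.card (PR k) = 4 * k := by
  rw [Fintype.card_prod, Fintype.card_prod, Fintype.card_multiplicative, Fintype.card_multiplicative,
    ZMod.card, ZMod.card]
  ring

/-- **The threshold.**  An involution-rectangle quadruple `Φ, Φu, Φ(wc), Φ(uwc)` (`u` an involution `∉ {1, c}`,
`w` of odd order `k ≥ 3` commuting with `u`) that is `SumTwo` without a conjugate pair forces `8k ≤ |G|`. -/
theorem eight_mul_le_card_of_rectQuad [Fintype G] [DecidableEq G] {k : ℕ} {c : G} (hc : IsComplexConj c)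
    {u w : G} (hu : u * u = 1) (hw : orderOf w = k) (huw : u * w = w * u) (hu1 : u ≠ 1) (huc : u ≠ c)
    (hk : 3 ≤ k) (hodd : Odd k) {Φ : Finset G} (hΦ : IsCMType c Φ) (hs : SumTwo (rectQuad Φ u w c))
    (hnc : ∀ i j : Fin 4, rectQuad Φ u w c j ≠ c • rectQuad Φ u w c i) : 8 * k ≤ Fintype.card G := by
  haveI : NeZero k := ⟨by omega⟩
  set ψ := rectHom k hc hu hw huw with hψdef
  have hψ : Function.Injective ψ := rectHom_injective k hodd hc hu hw huw hu1 huc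
  -- Lagrange: `4k ∣ |G|`
  have hdvd : 4 * k ∣ Fintype.card G := by
    have h := Subgroup.card_subgroup_dvd_card ψ.range
    rw [← Nat.card_congr (MonoidHom.ofInjective hψ).toEquiv, Nat.card_eq_fintype_card,
      Nat.card_eq_fintype_card, card_PR] at h
    exact h
  by_contra hlt
  rw [not_le] at hlt
  -- so `|G| = 4k` and `ψ` is bijective
  have hcard : Fintype.card G = 4 * k := by
    obtain ⟨m, hm⟩ := hdvd
    have hpos : 0 < Fintype.card G := Fintype.card_pos
    have : m = 1 := by
      rcases Nat.lt_or_ge m 2 with h | h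
      · interval_cases m
        · omega
        · rfl
      · have h2 : 4 * k * 2 ≤ 4 * k * m := Nat.mul_le_mul_left (4 * k) h
        omega
    rw [hm, this, mul_one]
  have hbij : Function.Bijective ψ :=
    (Fintype.bijective_iff_injective_and_card ψ).2 ⟨hψ, by rw [card_PR, hcard]⟩
  -- the pattern `χ p = [ψ p ∈ Φ]`
  let χ : PR k → Bool := fun p => decide (ψ p ∈ Φ)
  have hψc : ψ (rectConj k) = c := rectHom_conj k hc hu hw huw
  have hquad := rectQuad_eq_twists_odd k (by omega) Φ hc hu hw huw
  have hcm : ∀ p : PR k, χ (p * rectConj k) = !χ p := by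
    intro p
    show decide (ψ (p * rectConj k) ∈ Φ) = !decide (ψ p ∈ Φ)
    rw [map_mul, hψc, ← hc.comm, ← decide_not]
    congr 1
    exact propext (hΦ.conj_mem_iff (ψ p))
  have hst : ∀ p : PR k, (univ.filter fun j : Fin 4 => χ (p * (rectTwist k j)⁻¹) = true).card = 2 := by
    intro p
    have := hs (ψ p)
    rw [hquad] at this
    refine Eq.trans ?_ this
    congr 1
    apply Finset.filter_congr
    intro j _
    show decide (ψ (p * (rectTwist k j)⁻¹) ∈ Φ) = true ↔ ψ p ∈ rmul Φ (ψ (rectTwist k j))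
    rw [mem_rmul, map_mul, map_inv, decide_eq_true_iff]
  obtain ⟨i, j, hij⟩ := exists_conj_local k χ hcm hst
  apply hnc i j
  rw [hquad]
  ext x
  obtain ⟨p, rfl⟩ := hbij.2 x
  have h := hij p
  simp only [χ] at h
  rw [mem_rmul, hc.mem_smul_iff, mem_rmul, hc.comm]
  have key1 : ψ p * (ψ (rectTwist k j))⁻¹ = ψ (p * (rectTwist k j)⁻¹) := by rw [map_mul, map_inv]
  have key2 : ψ p * c * (ψ (rectTwist k i))⁻¹ = ψ (p * (rectConj k * (rectTwist k i)⁻¹)) := by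
    rw [map_mul, map_mul, map_inv, hψc, mul_assoc]
  rw [key1, key2, ← decide_eq_true_iff (p := ψ (p * (rectTwist k j)⁻¹) ∈ Φ),
    ← decide_eq_true_iff (p := ψ (p * (rectConj k * (rectTwist k i)⁻¹)) ∈ Φ), h]

/-- **The involution-rectangle criterion.**  Given `u`, `w` as above, a CM type whose twists by `1, u, wc, uwc`
are `SumTwo` without a conjugate pair exists IFF `8k ≤ |G|`. -/
theorem exists_rectQuad_odd_iff [Fintype G] [DecidableEq G] {k : ℕ} {c : G} (hc : IsComplexConj c) {u w : G}
    (hu : u * u = 1) (hw : orderOf w = k) (huw : u * w = w * u) (hu1 : u ≠ 1) (huc : u ≠ c) (hk : 3 ≤ k)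
    (hodd : Odd k) :
    (∃ Φ : Finset G, IsCMType c Φ ∧ SumTwo (rectQuad Φ u w c) ∧
      ∀ i j : Fin 4, rectQuad Φ u w c j ≠ c • rectQuad Φ u w c i) ↔ 8 * k ≤ Fintype.card G :=
  ⟨fun ⟨_, hΦ, hs, hnc⟩ => eight_mul_le_card_of_rectQuad hc hu hw huw hu1 huc hk hodd hΦ hs hnc,
    fun h => by
      haveI : NeZero k := ⟨by omega⟩
      exact exists_rectQuad_odd k hc hu hw huw hu1 huc hk hodd h⟩

end HodgeRepro.CosetQuad
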